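import Summits.QuantumFields.YangMills.Theorems.FemtoTransferGapRungW1up

/-!
# Large-field suppression for the one-site transfer form: `⟨ψ,K_Bψ⟩ ≤ e^{−Bη}·c(B)³·‖ψ‖²` when `S ≥ η` on the support of `ψ`
# (support module for the registered stub `stub_absUpper` — its OUTER half — of crux `OneSiteLevels`, route `LuscherReduction`,
# item stmt-QuantumFields-20007; fleet lead prover ym-luscher-20007-p1; line card `Lines/energy-lower-abs.md` (I4))

The OUTER bound of the crux (`OneSiteAbsUpperOuter`, skeleton v7) controls the `sin Θ_B`-piece of a physical test function, which lives where
some link is farther than `√λ_b` from the centre.  That region splits into (a) the LARGE-FIELD part, where the magnetic energy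
`S(U) = Σ_p (2 − Re tr[U_i,U_j])` is bounded below, and (b) the neighbourhood of the toron VALLEY of commuting triples (transverse confinement —
the L-sized analysis not done here).  This module settles (a) in the W1-up chain's language: since
`K_B(U,V) = E_B(U,V)·e^{−(B/2)(S(U)+S(V))}` (`transferKernel_eq_linkE_mul`) and the pure kinetic kernel `E_B` has the Schur bound
`∫∫ φ E_B φ ≤ linkCE B ‖φ‖²` (row sums `linkCE B = c(B)³`),

  `qform_le_exp_neg_of_action_ge`:  `S ≥ η` on `{ψ ≠ 0}`  ⟹  `⟨ψ,K_Bψ⟩ ≤ e^{−Bη} · linkCE B · ‖ψ‖²`   (`B ≥ 0`),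

and the two-sided support version `qform_le_exp_neg_half_of_action_ge` (`S ≥ η` only on the support of ONE factor costs `e^{−Bη/2}`).
With `η ≫ λ_b⁴` (e.g. any fixed `η > 0`, or `η = λ_b³`), `e^{−Bη} = e^{−2η/λ_b³} ≪ e^{−λ_b(E_k+1)}`: large fields never intrude.

## WHAT THIS IS NOT
Not the valley part of OUTER; NOT the crux, NOT THE CLAY GAP.  Sorry-free; no new definition, no named fact.
-/

set_option autoImplicit false

noncomputable section

open MeasureTheory Filter Topology Real
open scoped Matrix ComplexConjugate BigOperators
open Literature.MathematicalPhysics.QuantumFieldTheory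
open Literature.MathematicalPhysics.QuantumLattice

namespace Summit.QuantumFields.YangMills.Theorems.FemtoTransferGap

/-- Pointwise: if `S ≥ η` wherever `ψ ≠ 0`, then `ψ(U) K_B(U,V) ψ(V) ≤ e^{−Bη} · ½(ψ(U)² + ψ(V)²) · E_B(U,V)` (`B ≥ 0`). [folklore] -/
theorem kernel_pointwise_le_of_action_ge {B : ℝ} (hB : 0 ≤ B) {ψ : Cfg → ℝ} {η : ℝ}
    (hη : ∀ U, ψ U ≠ 0 → η ≤ wilsonAction su2Rep U) (p : Cfg × Cfg) :
    ψ p.1 * transferKernel su2Rep B p.1 p.2 * ψ p.2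
      ≤ Real.exp (-(B * η)) * ((1 / 2 : ℝ) * (linkE B p.1 p.2 * ψ p.1 ^ 2) + (1 / 2 : ℝ) * (linkE B p.1 p.2 * ψ p.2 ^ 2)) := by
  by_cases h0 : ψ p.1 = 0 ∨ ψ p.2 = 0
  · have hE := (linkE_pos B p.1 p.2).le
    have hR : 0 ≤ Real.exp (-(B * η)) * ((1 / 2 : ℝ) * (linkE B p.1 p.2 * ψ p.1 ^ 2) + (1 / 2 : ℝ) * (linkE B p.1 p.2 * ψ p.2 ^ 2)) :=
      mul_nonneg (Real.exp_pos _).le (add_nonneg (mul_nonneg (by norm_num) (mul_nonneg hE (sq_nonneg _)))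
        (mul_nonneg (by norm_num) (mul_nonneg hE (sq_nonneg _))))
    have hL : ψ p.1 * transferKernel su2Rep B p.1 p.2 * ψ p.2 = 0 := by
      rcases h0 with h | h <;> rw [h] <;> ring
    rw [hL]
    exact hR
  · push Not at h0
    have hU := hη p.1 h0.1
    have hV := hη p.2 h0.2
    rw [transferKernel_eq_linkE_mul]
    have hexp : Real.exp (-(B / 2) * (wilsonAction su2Rep p.1 + wilsonAction su2Rep p.2)) ≤ Real.exp (-(B * η)) :=
      Real.exp_le_exp.mpr (by nlinarith)
    have hE := (linkE_pos B p.1 p.2).le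
    have hamgm : ψ p.1 * ψ p.2 ≤ (1 / 2 : ℝ) * (ψ p.1 ^ 2 + ψ p.2 ^ 2) := by nlinarith [sq_nonneg (ψ p.1 - ψ p.2)]
    have habs : |ψ p.1 * ψ p.2| ≤ (1 / 2 : ℝ) * (ψ p.1 ^ 2 + ψ p.2 ^ 2) := by
      rw [abs_le]; constructor <;> nlinarith [sq_nonneg (ψ p.1 + ψ p.2), sq_nonneg (ψ p.1 - ψ p.2)]
    calc ψ p.1 * (linkE B p.1 p.2 * Real.exp (-(B / 2) * (wilsonAction su2Rep p.1 + wilsonAction su2Rep p.2))) * ψ p.2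
        = (ψ p.1 * ψ p.2) * (linkE B p.1 p.2 * Real.exp (-(B / 2) * (wilsonAction su2Rep p.1 + wilsonAction su2Rep p.2))) := by ring
      _ ≤ |ψ p.1 * ψ p.2| * (linkE B p.1 p.2 * Real.exp (-(B * η))) := by
          refine (le_abs_self _).trans ?_
          rw [abs_mul (ψ p.1 * ψ p.2), abs_of_nonneg (mul_nonneg hE (Real.exp_pos _).le)]
          exact mul_le_mul_of_nonneg_left (mul_le_mul_of_nonneg_left hexp hE) (abs_nonneg _)
      _ ≤ (1 / 2 : ℝ) * (ψ p.1 ^ 2 + ψ p.2 ^ 2) * (linkE B p.1 p.2 * Real.exp (-(B * η))) :=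
          mul_le_mul_of_nonneg_right habs (mul_nonneg hE (Real.exp_pos _).le)
      _ = Real.exp (-(B * η)) * ((1 / 2 : ℝ) * (linkE B p.1 p.2 * ψ p.1 ^ 2) + (1 / 2 : ℝ) * (linkE B p.1 p.2 * ψ p.2 ^ 2)) := by
          ring

/-- **Large-field suppression.**  If the magnetic energy is at least `η` wherever the physical test function `ψ` does not vanish, then
`⟨ψ,K_Bψ⟩ ≤ e^{−Bη} · linkCE B · ‖ψ‖²` (`B ≥ 0`; Schur row/column sums of the kinetic kernel `E_B`). [cite: Luscher1983, §2] -/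
theorem qform_le_exp_neg_of_action_ge {B : ℝ} (hB : 0 ≤ B) {ψ : Cfg → ℝ} (hψ : IsPhys ψ) {η : ℝ}
    (hη : ∀ U, ψ U ≠ 0 → η ≤ wilsonAction su2Rep U) :
    qform su2Rep B ψ ψ ≤ Real.exp (-(B * η)) * linkCE B * l2 ψ ψ := by
  obtain ⟨C, hC⟩ := hψ.bounded
  have hm := hψ.measurable
  have hψ2m : Measurable fun U => ψ U ^ 2 := hm.pow_const 2
  have hψ2b : ∀ U, |ψ U ^ 2| ≤ C ^ 2 := fun U => by
    rw [abs_pow]; exact pow_le_pow_left₀ (abs_nonneg _) (hC U) 2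
  have e1 := integral_prod_linkE_mul_fst B hψ2m hψ2b hB
  have e2 := integral_prod_linkE_mul_snd B hψ2m hψ2b hB
  have hG1 : Integrable (fun p : Cfg × Cfg => linkE B p.1 p.2 * ψ p.1 ^ 2) ((configMeasure SU2 1).prod (configMeasure SU2 1)) := by
    refine integrable_cfgProd ((measurable_linkE B).mul (hψ2m.comp measurable_fst))
      (C := Real.exp (2 * B) ^ Fintype.card (Edge 3 1) * C ^ 2) fun p => ?_
    rw [abs_mul]; exact mul_le_mul (abs_linkE_le hB _ _) (hψ2b _) (abs_nonneg _) (by positivity)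
  have hG2 : Integrable (fun p : Cfg × Cfg => linkE B p.1 p.2 * ψ p.2 ^ 2) ((configMeasure SU2 1).prod (configMeasure SU2 1)) := by
    refine integrable_cfgProd ((measurable_linkE B).mul (hψ2m.comp measurable_snd))
      (C := Real.exp (2 * B) ^ Fintype.card (Edge 3 1) * C ^ 2) fun p => ?_
    rw [abs_mul]; exact mul_le_mul (abs_linkE_le hB _ _) (hψ2b _) (abs_nonneg _) (by positivity)
  have hG : Integrable (fun p : Cfg × Cfg => Real.exp (-(B * η)) * ((1 / 2 : ℝ) * (linkE B p.1 p.2 * ψ p.1 ^ 2) +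
      (1 / 2 : ℝ) * (linkE B p.1 p.2 * ψ p.2 ^ 2))) ((configMeasure SU2 1).prod (configMeasure SU2 1)) :=
    ((hG1.const_mul _).add (hG2.const_mul _)).const_mul _
  have hF := integrable_sandwich' (measurable_transferKernel_su2 B) (abs_transferKernel_le hB) hm hm hC hC
  have hl2 : l2 ψ ψ = ∫ U, ψ U ^ 2 ∂configMeasure SU2 1 := by
    unfold l2; congr 1; funext U; ring
  rw [qform_eq_integral_cfgProd hB hψ]
  calc ∫ p, ψ p.1 * transferKernel su2Rep B p.1 p.2 * ψ p.2 ∂(configMeasure SU2 1).prod (configMeasure SU2 1)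
      ≤ ∫ p, Real.exp (-(B * η)) * ((1 / 2 : ℝ) * (linkE B p.1 p.2 * ψ p.1 ^ 2) + (1 / 2 : ℝ) * (linkE B p.1 p.2 * ψ p.2 ^ 2))
          ∂(configMeasure SU2 1).prod (configMeasure SU2 1) :=
        integral_mono hF hG (kernel_pointwise_le_of_action_ge hB hη)
    _ = Real.exp (-(B * η)) * ((1 / 2 : ℝ) * (linkCE B * ∫ U, ψ U ^ 2 ∂configMeasure SU2 1) +
          (1 / 2 : ℝ) * (linkCE B * ∫ U, ψ U ^ 2 ∂configMeasure SU2 1)) := by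
        rw [integral_const_mul, integral_add (hG1.const_mul _) (hG2.const_mul _), integral_const_mul, integral_const_mul, e1, e2]
    _ = Real.exp (-(B * η)) * linkCE B * l2 ψ ψ := by rw [hl2]; ring

/-- **Large-field suppression in `λ_b` units**: with `Bλ_b³ = 2`, `e^{−Bη} = e^{−2η/λ_b³}`; in particular for `η = t·λ_b³/2` the factor is
`e^{−t}`.  Any region of magnetic energy `S ≥ t λ_b³/2` contributes at most `e^{−t}·linkCE‖ψ‖²` — so `S ≥ λ_b²` (say) is super-exponentially
negligible against the `e^{−λ_b E}` scale of the crux. [cite: Luscher1983, §2] -/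
theorem qform_le_exp_neg_of_action_ge_lambda {B : ℝ} (hB : 0 < B) {ψ : Cfg → ℝ} (hψ : IsPhys ψ) {t : ℝ}
    (ht : ∀ U, ψ U ≠ 0 → t * bareLambda B ^ 3 / 2 ≤ wilsonAction su2Rep U) :
    qform su2Rep B ψ ψ ≤ Real.exp (-t) * linkCE B * l2 ψ ψ := by
  have h := qform_le_exp_neg_of_action_ge hB.le hψ ht
  have hcube := bareLambda_cube hB
  have e : B * (t * bareLambda B ^ 3 / 2) = t := by
    calc B * (t * bareLambda B ^ 3 / 2) = t * (B * bareLambda B ^ 3) / 2 := by ring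
      _ = t := by rw [hcube]; ring
  rwa [e] at h

end Summit.QuantumFields.YangMills.Theorems.FemtoTransferGap

end
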